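import Summits.RiemannHypothesis.RiemannHypothesis.Theses.OddSector
import Summits.RiemannHypothesis.RiemannHypothesis.Theorems.OddSectorOddNegativityOffLine
import Summits.RiemannHypothesis.RiemannHypothesis.Theorems.OddSectorOddOneSignedWindowsEulerLagrangeTransfer
import Literature.NumberTheory.LFunctions.WeilOddGroundState
import HarnessLib

/-!
# `OddOneSignedWindows` (stmt-RiemannHypothesis-17778): load-bearing clauses (negative lemmas of the standing disprover, cycle 1)

Crux of route OddSector, rank 2: `OddOneSignedWindows ↔ ∀ A, ∃ a ≥ A, ∃ u, IsWeilOddGroundState a u ∧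
(∀ᵐ t ∈ (0,a), Im u t = 0 ∧ 0 ≤ Re u t)` (`Iff.rfl`). No refutation exists (both `X` and `¬X` are
RH-strength — see `Cruxes/OddOneSignedWindows/Disproof.lean` and the mechanism obstruction
`Negative/OddFoldRaisesEnergy.lean`); this file lands the kernel-checked MUTATION TABLE of the
crux. Every statement is inline (no new `def`); no conclusion asserts a Theses decl.

* `not_oddOneSignedWindows_of_floor_of_not_rh`: `OddBartaFloor → ¬RH → ¬X` (the deciding theorem
  `closes` with the PROVED item `OddNegativityOffLine`): the only conceivable source of `¬X`.
* `withoutReality_holds`: with `Im u = 0` deleted the sign clause is junk-satisfiable (`u = I·v`,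
  `Re u ≡ 0`) — reality is load-bearing (refuter-rattack's observation, landed).
* `withoutMinimising_holds`: with "minimising" deleted the crux is trivial (an explicit normalised
  smooth odd bump, positive on `(0,a)`, as a constant sequence) — minimisation is load-bearing.
* `not_fullWindow_oneSigned`: the sign clause on the WHOLE window `(-a,a)` is unsatisfiable by any
  odd-sector ground state (oddness a.e. ⇒ `u = 0` a.e., contradicting `‖u‖₂ = 1`) — the
  half-window is the only non-vacuous formulation.
(With the sign clause, resp. `0 ≤ Re u`, deleted the crux is already a theorem of the tree:
`exists_isWeilOddGroundState_unbounded`, `exists_isWeilOddGroundState_real_unbounded`.)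
-/

noncomputable section

open Filter Set MeasureTheory
open scoped Topology

namespace Summit.RiemannHypothesis.Cruxes.OddOneSignedWindows.Negative

open Literature.NumberTheory.LFunctions
open Summit.RiemannHypothesis.RiemannHypothesis.Theses.OddSector
open Summit.RiemannHypothesis.RiemannHypothesis.Theorems (oddNegativityOffLine_proof)
open Summit.RiemannHypothesis.RiemannHypothesis.Theorems.OddSector
  (exists_isWeilOddGroundState_real_unbounded)

/-- **`¬X` from the floor and `¬RH`.** With `OddNegativityOffLine` proved, the route's deciding
theorem gives `OddBartaFloor → OddOneSignedWindows → RH`; contrapose. [folklore] -/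
theorem not_oddOneSignedWindows_of_floor_of_not_rh (hB : OddBartaFloor)
    (hRH : ¬ _root_.RiemannHypothesis) : ¬ OddOneSignedWindows :=
  fun hX ↦ hRH (closes hB hX oddNegativityOffLine_proof)

/-- **Reality is load-bearing**: deleting `Im u = 0` from the sign clause makes the crux a
theorem by a junk witness — `u = I·v` for a real-valued odd ground state `v` (phase invariance,
`IsWeilOddGroundState.const_mul`) has `Re u ≡ 0 ≥ 0`. [folklore] -/
theorem withoutReality_holds :
    ∀ A : ℝ, ∃ a : ℝ, A ≤ a ∧ ∃ u : ℝ → ℂ, IsWeilOddGroundState a u ∧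
      ∀ᵐ t : ℝ, t ∈ Ioo 0 a → 0 ≤ (u t).re := by
  intro A
  obtain ⟨a, ha, v, hv, hreal⟩ := exists_isWeilOddGroundState_real_unbounded A
  refine ⟨a, ha, fun t ↦ Complex.I * v t, hv.const_mul (by simp), Eventually.of_forall fun t _ ↦ ?_⟩
  rw [Complex.mul_re, Complex.I_re, Complex.I_im, hreal t]
  simp

/-- **Minimisation is load-bearing**: deleting "minimising" (keeping `u ∈ L²`, a normalised smooth
odd window sequence converging to `u` in `L²`, and the sign clause) makes the crux trivial — an
explicit normalised odd bump `u = c(φ − φ(−·))`, `φ` a bump at `a/2` of radius `a/4`, positive on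
`(0, a)`, as the constant sequence. [folklore] -/
theorem withoutMinimising_holds :
    ∀ A : ℝ, ∃ a : ℝ, A ≤ a ∧ ∃ u : ℝ → ℂ, (MemLp u 2 ∧ ∃ g : ℕ → ℝ → ℂ,
      (∀ n, IsWeilTest (g n) ∧ tsupport (g n) ⊆ Icc (-a) a ∧ (∀ t, g n (-t) = -g n t) ∧
        ∫ t, ‖g n t‖ ^ 2 = (1 : ℝ)) ∧
      Tendsto (fun n ↦ ∫ t, ‖g n t - u t‖ ^ 2) atTop (𝓝 0)) ∧
      ∀ᵐ t : ℝ, t ∈ Ioo 0 a → (u t).im = 0 ∧ 0 ≤ (u t).re := by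
  intro A
  set a : ℝ := max A 1 with ha
  have ha1 : 1 ≤ a := le_max_right _ _
  -- a bump at `a/2` with radii `a/8 < a/4`
  let φ : ContDiffBump (a / 2) := ⟨a / 8, a / 4, by positivity, by linarith⟩
  have hOut : φ.rOut = a / 4 := rfl
  have hφs : ∀ y, φ y ≠ 0 → a / 4 < y ∧ y < 3 * a / 4 := fun y hy ↦ by
    have hy' : y ∈ Function.support (φ : ℝ → ℝ) := hy
    rw [φ.support_eq, Metric.mem_ball, Real.dist_eq, abs_lt, hOut] at hy'
    constructor <;> linarith [hy'.1, hy'.2]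
  -- the odd real test `w = φ − φ(−·)` and its normalisation
  set w : ℝ → ℂ := fun x ↦ ((φ x - φ (-x) : ℝ) : ℂ) with hw
  have hwc : HasCompactSupport w := by
    refine HasCompactSupport.intro (K := Icc (-a) a) isCompact_Icc fun x hx ↦ ?_
    rw [mem_Icc, not_and_or, not_le, not_le] at hx
    have h1 : φ x = 0 := by
      by_contra h
      have b := hφs _ h
      rcases hx with hx | hx <;> linarith
    have h2 : φ (-x) = 0 := by
      by_contra h
      have b := hφs _ h
      rcases hx with hx | hx <;> linarith
    simp [hw, h1, h2]
  have hwt : IsWeilTest w :=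
    ⟨Complex.ofRealCLM.contDiff.comp (φ.contDiff.sub (φ.contDiff.comp contDiff_neg)), hwc⟩
  have hws : tsupport w ⊆ Icc (-a) a := by
    refine closure_minimal (fun x hx ↦ ?_) isClosed_Icc
    by_contra hn
    rw [mem_Icc, not_and_or, not_le, not_le] at hn
    have h1 : φ x = 0 := by
      by_contra h
      have b := hφs _ h
      rcases hn with hn | hn <;> linarith
    have h2 : φ (-x) = 0 := by
      by_contra h
      have b := hφs _ h
      rcases hn with hn | hn <;> linarith
    exact hx (by simp [hw, h1, h2])
  have hwo : ∀ t, w (-t) = -w t := fun t ↦ by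
    simp only [hw, neg_neg]
    push_cast
    ring
  -- `w ≠ 0`, so it can be normalised
  set N : ℝ := ∫ t, ‖w t‖ ^ 2 with hN
  have hN0 : 0 ≤ N := integral_nonneg fun t ↦ by positivity
  have hNne : N ≠ 0 := by
    intro h0
    have hw0 := hwt.eq_zero_of_integral_norm_sq_eq_zero h0
    have h1 : φ (a / 2) = 1 := φ.one_of_mem_closedBall (Metric.mem_closedBall_self (by positivity))
    have h2 : φ (-(a / 2)) = 0 := by
      by_contra h
      have b := hφs _ h
      linarith [b.1]
    have : w (a / 2) = 0 := by rw [hw0]; rfl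
    simp [hw, h1, h2] at this
  have hNpos : 0 < N := lt_of_le_of_ne hN0 (Ne.symm hNne)
  set c : ℝ := (Real.sqrt N)⁻¹ with hc
  have hcpos : 0 < c := inv_pos.2 (Real.sqrt_pos.2 hNpos)
  have hc2 : c ^ 2 * N = 1 := by
    rw [hc, inv_pow, Real.sq_sqrt hNpos.le, inv_mul_cancel₀ hNne]
  set u : ℝ → ℂ := fun x ↦ (c : ℂ) * w x with hu
  have hut : IsWeilTest u := hwt.const_mul _
  have hun : ∫ t, ‖u t‖ ^ 2 = (1 : ℝ) := by
    have e : ∀ x, ‖u x‖ ^ 2 = c ^ 2 * ‖w x‖ ^ 2 := fun x ↦ by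
      rw [hu, norm_mul, mul_pow, Complex.norm_real, Real.norm_of_nonneg hcpos.le]
    simp_rw [e]
    rw [integral_const_mul]
    exact hc2
  refine ⟨a, le_max_left _ _, u, ⟨hut.memLp_two, fun _ ↦ u, fun _ ↦ ⟨hut,
    tsupport_mul_subset_right.trans hws, fun t ↦ by simp only [hu, hwo, mul_neg], hun⟩, ?_⟩, ?_⟩
  · simp
  · refine Eventually.of_forall fun t ht ↦ ?_
    have h2 : φ (-t) = 0 := by
      by_contra h
      have b := hφs _ h
      linarith [b.1, ht.1]
    simp only [hu, hw, h2, sub_zero, Complex.mul_im, Complex.ofReal_re, Complex.ofReal_im,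
      Complex.mul_re, mul_zero, zero_mul, add_zero, sub_zero]
    exact ⟨trivial, mul_nonneg hcpos.le φ.nonneg⟩

/-- **The sign clause cannot be asked on the WHOLE window.** No odd-sector ground state is real
and `≥ 0` a.e. on `(-a, a)`: oddness a.e. (`IsWeilOddGroundState.ae_neg`) forces `u = 0` a.e. on
the window, localisation (`ae_eq_zero_of_notMem`) off it, contradicting `‖u‖₂ = 1`. [folklore] -/
theorem not_fullWindow_oneSigned :
    ¬ ∃ a : ℝ, ∃ u : ℝ → ℂ, IsWeilOddGroundState a u ∧
      ∀ᵐ t : ℝ, t ∈ Ioo (-a) a → (u t).im = 0 ∧ 0 ≤ (u t).re := by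
  rintro ⟨a, u, hu, hsign⟩
  have hodd := hu.ae_neg
  have hsign' : ∀ᵐ t : ℝ, -t ∈ Ioo (-a) a → (u (-t)).im = 0 ∧ 0 ≤ (u (-t)).re :=
    (Measure.measurePreserving_neg (volume : Measure ℝ)).quasiMeasurePreserving.tendsto_ae.eventually
      hsign
  have hout := hu.ae_eq_zero_of_notMem
  have hend : ∀ᵐ t : ℝ, t ∉ ({a, -a} : Set ℝ) :=
    compl_mem_ae_iff.2 ((Set.toFinite ({a, -a} : Set ℝ)).measure_zero volume)
  have hzero : ∀ᵐ t : ℝ, ‖u t‖ ^ 2 = ‖(0 : ℝ → ℂ) t‖ ^ 2 := by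
    filter_upwards [hodd, hsign, hsign', hout, hend] with t ht h1 h2 h3 h4
    simp only [Pi.zero_apply, norm_zero, ne_eq, OfNat.ofNat_ne_zero, not_false_eq_true, zero_pow,
      pow_eq_zero_iff, norm_eq_zero]
    by_cases hm : t ∈ Ioo (-a) a
    · have hm' : -t ∈ Ioo (-a) a := ⟨by linarith [hm.2], by linarith [hm.1]⟩
      obtain ⟨hi, hr⟩ := h1 hm
      obtain ⟨-, hr'⟩ := h2 hm'
      rw [ht, Complex.neg_re] at hr'
      exact Complex.ext (by rw [Complex.zero_re]; linarith) (by rw [Complex.zero_im]; exact hi)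
    · refine h3 fun hI ↦ ?_
      simp only [mem_insert_iff, mem_singleton_iff, not_or] at h4
      exact hm ⟨lt_of_le_of_ne hI.1 (Ne.symm h4.2), lt_of_le_of_ne hI.2 h4.1⟩
  have h1 : ∫ t, ‖u t‖ ^ 2 = 0 := by
    rw [integral_congr_ae hzero]
    simp
  have h2 := hu.integral_norm_sq
  linarith

end Summit.RiemannHypothesis.Cruxes.OddOneSignedWindows.Negative

end
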